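import Summits.ABC.IUTFork.DAGL6b
import Summits.ABC.IUTFork.DAGL6c
import Summits.ABC.IUTFork.DAGL6s
import Summits.ABC.IUTFork.DAGL6t
import Summits.ABC.IUTFork.DAGL6u
import Summits.ABC.IUTFork.DAGL6x
import Summits.ABC.IUTFork.DAGL6y
import Summits.ABC.IUTFork.DAGL6z
import Summits.ABC.IUTFork.DAGL6za
import Summits.ABC.IUTFork.DAGL6zb
import Summits.ABC.IUTFork.DAGC312k
import Summits.ABC.IUTFork.DAGC312n
import Summits.ABC.IUTFork.DAGUa
import Literature.RingTheory.Etale.PiTensorProductLocallyEtale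
import Summits.ABC.IUTFork.DAGRa
import Summits.ABC.IUTFork.DAGRb
import Summits.ABC.IUTFork.DAGRc
import Summits.ABC.IUTFork.DAGRe
import Summits.ABC.IUTFork.DAGRf
import Summits.ABC.IUTFork.DAGUc
import Summits.ABC.IUTFork.DAGUd
import Summits.ABC.IUTFork.DAGUe
import Summits.ABC.IUTFork.DAGXa
import Summits.ABC.IUTFork.DAGXc
import HarnessLib

/-!
# L6 layer certificate, part B: the [IUTchIII] §1–3 slice of the Cor. 3.12 cone (director-abc (C2); L6-lead spec `plan/L6/CERT-L6.md` v0, conventions §F v1.19n K1–K5; placements = CERT-L6-MAP v17, abc-iut-L6-t8)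

COUNT LINE (part B, grammar §F v1.19s «N = d_nodes + d_idx + r + d_data + f»): **[IUTchIII] cone members 69 = d_nodes 61 (NODES-discharged,
lead-certified print coverage) + d_idx 0 (index-discharged: kernel witness, print coverage not lead-certified) + r 0 (Residual conjuncts:
lead-uncertified print coverage, kernel-inhabited via index `_part` witnesses) + d_data 8 (constructed / definition / output-signature data, LISTED
below, no conjunct) + f 0 (flagged, LISTED, no conjunct)**; Discharged conjuncts in all: 141 (index Props + their closed sub-rows) for 61 nodes;
status source plan/L6/NODES.md v3.4aq; S consumed at L6: NO (S = `PilotKummerIndRelated` enters at the Cor. 3.12 node, c312's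
layer); FACT-LIST facts as FREE hypotheses of this file: none (every conjunct is a closed Prop). Named inputs in HYPOTHESIS
position INSIDE the conjoined statements (abc-iut-w5-d109 g4 memo AUDIT_Layer6OfSb_TREE_p428159 c23cc38314ac9ce8 / L6-SLICE-INPUT-CENSUS
d889dbec7c7c1df3): model-witness F-0429 `LogLinkVolumeCompatible`, F-2114 `Prop39ii_monoAnalyticCompat`; conditional F-1998 `FKit.RlfOfIsStrip`,
F-2066 `BiCoricData.RealifiedRigidAt`; vocabulary predicates F-1996/F-1997/F-2072/F-2092; interface bundles (`GlobalFrobenioidModels.ModelHyps`,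
`TemperedThetaMonoids.Prop31Statements`, `LogLink.IsFull`, …) — inputs named, not endorsed.

WHAT THIS FILE IS. abc-iut cell, seat abc-iut-L6-d4 (gen 4), row CERT-L6-B. The Cor. 3.12 cone (plan/COR312-CONE.tsv) has 188
L6 members; this part packages the 69 [IUTchIII] §1–3 members (plan/L6/CERT-L6-CONE.tsv) against the kernel index
`Summits/ABC/IUTFork/DAG*.lean` (abc-iut-c312-2 / abc-iut-dag), row by row as placed by CERT-L6-MAP v17
(HOME/staging/L6/L6-t8/cert/CERT-L6-MAP-v17-partB.tsv). Conventions = L6-lead §F v1.19n K1–K5 (full text: plan/L6/CERT-L6.md and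
versions v0–v5 of this file): (K1) index Prop with `_holds` ⇒ Discharged conjunct BY NAME (+ its closed sub-rows `N_<id>_r<n>` /
`_L<nn>` with their `_holds`); (K2) `_part`-only index Prop ⇒ Discharged iff NODES.md says discharged, else Residual (bare name,
kernel-inhabited via `_part`); (K3) NO Prop-valued schema is ever ∀-closed — heads dropped, closed sub-rows / closing theorems BY NAME
(`StatementOfB @thm`); (K4) data / definition / output-signature nodes LISTED, not conjoined; (K5) unindexed nodes by typed decl.
Universe levels are the index's names `u₁ …`, shared; no `Type 0`.
R-def = option (b) WITH SPLIT COUNT (L6-lead §F v1.19s): a NODES-landed Definition node whose index Prop has a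
kernel witness is a Discharged conjunct tagged d_idx «index-discharged; print coverage not lead-certified», kept
apart from d_nodes «NODES-discharged (lead-certified print coverage, p-ids)»; the L6 SCOREBOARD is the
NODES-discharged count. RESIDUAL r = NODES-landed claim nodes (lead-uncertified print coverage); every residual
conjunct is KERNEL-INHABITED through its index witness (`layer6ResidualB_inhabited` below; abc-iut-w5-d223 g3 R2
probes) — r is a print-coverage count, not a logical debt.
Residual universe arity kept at 3 (top compatibility): 3 content-free stabiliser conjunct(s) `∀ α : Sort u, Nonempty
α → Nonempty α` appended (not cone rows, not counted in r).

* `Layer6DischargedB` / `layer6DischargedB_holds` — 141 conjuncts for 61 nodes, PROVED by the anonymous constructor over the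
  index witnesses BY NAME (terms only; nothing re-proved or re-typed).
* `Layer6ResidualB` — 0 node conjunct(s) = the [IUTchIII] §1–3 entries of L6 still «landed» on the C scoreboard — EMPTY at v3.4aq (stabiliser conjuncts only); `layer6ResidualB_inhabited` proves it BY NAME.
* `Layer6ConeB := Layer6DischargedB ∧ Layer6ResidualB`; `layer6ConeB_of : Layer6ResidualB → Layer6ConeB`.

d_data — constructed / definition / output-signature DATA nodes (8; no truth value, hence no conjunct):
* `IUTchIII:Def2.4(iii)` — constructed (data): N_IUTchIII_Def2_4_iii := @Literature.IUT.LogThetaLattice.GlQuadruple (p405292); NODES=landed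
* `IUTchIII:Def3.8(i)` — constructed (definition/predicate): N_IUTchIII_Def3_8_i (index alias of a Prop-valued schema, arity 3) (p403954); NODES=discharged
* `IUTchIII:Def3.8(iii)` — constructed (data): N_IUTchIII_Def3_8_iii := @Literature.IUT.LogThetaLattice.LGPGaussianLogThetaLattice (p403954); NODES=discharged:p403954
* `IUTchIII:Ex3.6(i)` — constructed (data): N_IUTchIII_Ex3_6_i := @Literature.IUT.LogThetaLattice.GlobalFrobenioidModels.MODObj (p413105); NODES=discharged:p413105
* `IUTchIII:Ex3.6(iii)` — constructed (data): N_IUTchIII_Ex3_6_iii := @Literature.IUT.LogThetaLattice.GlobalFrobenioidModels.FrakObj.toMOD (p413704); NODES=discharged:p413704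
* `IUTchIII:Prop3.10(i)` — constructed (data): N_IUTchIII_Prop3_10_i := @Literature.IUT.LogThetaLattice.VerticallyCoricGlobalData (p404134); NODES=discharged:p414241
* `IUTchIII:Prop3.2(i)` — constructed (data): N_IUTchIII_Prop3_2_i := @Literature.IUT.LogThetaLattice.MPacket1.compat (p407610); NODES=discharged:p407610
* `IUTchIII:Prop3.7(iii)` — constructed (data): N_IUTchIII_Prop3_7_iii := @Literature.IUT.LogThetaLattice.LGPStripName (p403954); NODES=discharged:p417019

f — FLAGGED: 0 (none since MAP v8 — F1/F2/F3 acted, see INDEX FLAGS below).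
Deviations from CERT-L6-MAP v17: none (the MAP adopted the kernel-forced conventions D1/D2 of v3: schema heads dropped, closed sub-rows / closing theorems BY NAME; Def3.8(i) listed).

INDEX FLAGS F1/F2/F3 raised by v0–v5 are ALL ACTED by abc-iut-c312-2 (07:15:03Z) and CITED here from MAP v8 on (index inputs
regenerated by abc-iut-L6-t8 g6 from a farm probe of every DAG* part): (F1) re-key `N_IUTchIII_Prop1_3_iii'` (+ sub-row `_r6'`, DAGRa);
(F2) re-keys `N_IUTchIII_Prop1_2_vi'` / `N_IUTchIII_Prop1_2_vii'` with `_holds` (DAGRb); (F3) `N_IUTchIII_Prop3_7_iv` indexed (DAGXa).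
HONEST FRAMING: this file PROVES NOTHING NEW and ASSERTS NOTHING about [IUTchIII] Cor. 3.12; it packages kernel facts BY NAME so that
the apex `Conditional/AbcOfS.lean` can take ONE binder for L6. typed ≠ proved; indexed ≠ endorsed; no side taken on Cor. 3.12;
nothing here says abc is proved or refuted. [claim: Mochizuki2012, status: disputed] (node texts).
Version: v13 [= 16th filing, «B v16» on STATUS] (R-def b; NODES v3.4aq: L6-t3's DEF11 flips IUTchIII:Def1.1(i)(ii)(iii)(iv)(v)(vi) d_idx → d_nodes ⇒ part B has NO d_idx row left; node residual EMPTY (r 0; 3 content-free stabilisers); data rows Def3.8(i)(iii) NODES-discharged (notes); MAP v17) 2026-08-26T10:5xZ (maintainer abc-iut-L6-t8 g6 since 2026-08-26T07:23Z with abc-iut-L6-d4 g4's kit v2 / gen_b5.py; author of record of v0–v5 abc-iut-L6-d4 g4; earlier drafts superseded; re-filed whole per NODES version, §F v1.19w).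
-/

namespace Summit.ABC.IUTFork.Conditional

open Summit.ABC.IUTFork.DAG

/-- Bookkeeping (same device as the index's `DAG.PartL6b.StatementOf`): the STATEMENT of a landed theorem `h`, so that a
closing theorem can be cited BY NAME as a conjunct without re-typing its content. [claim: Mochizuki2012, status: disputed] -/
abbrev StatementOfB {P : Prop} (_h : P) : Prop := P

/-- **L6 certificate, part B — DISCHARGED [IUTchIII] cone nodes (61 nodes = d_nodes 61 NODES-discharged + d_idx 0 index-discharged;
141 conjuncts: index Props and their closed sub-rows BY NAME).** See the line comment above each node's conjuncts (node · tag · rule).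
[claim: Mochizuki2012, status: disputed] -/
def Layer6DischargedB.{u₁, u₂, u₃, u₄, u₅, u₆} : Prop :=
  --  [IUTchIII:Cor2.3(i)] d_nodes: NODES-discharged p411723; K1
  N_IUTchIII_Cor2_3_i.{u₁} ∧
  --  [IUTchIII:Cor2.3(ii)] d_nodes: NODES-discharged p412150; K1
  N_IUTchIII_Cor2_3_ii.{u₁} ∧
  N_IUTchIII_Cor2_3_ii_r3.{u₁} ∧
  N_IUTchIII_Cor2_3_ii_r5.{u₁} ∧
  N_IUTchIII_Cor2_3_ii_r6.{u₁} ∧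
  --  [IUTchIII:Cor2.3(iii)] d_nodes: NODES-discharged p411950; K1
  N_IUTchIII_Cor2_3_iii.{u₁} ∧
  N_IUTchIII_Cor2_3_iii_r12.{u₁} ∧
  --  [IUTchIII:Cor2.3(iv)] d_nodes: NODES-discharged p412150; K1
  N_IUTchIII_Cor2_3_iv.{u₁} ∧
  N_IUTchIII_Cor2_3_iv_r14.{u₁} ∧
  N_IUTchIII_Cor2_3_iv_r15.{u₁} ∧
  N_IUTchIII_Cor2_3_iv_r17.{u₁} ∧
  --  [IUTchIII:Def1.1(i)] d_nodes: NODES-discharged p403834; K1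
  N_IUTchIII_Def1_1_i.{u₁} ∧
  --  [IUTchIII:Def1.1(ii)] d_nodes: NODES-discharged p403834; K1
  N_IUTchIII_Def1_1_ii.{u₁} ∧
  --  [IUTchIII:Def1.1(iii)] d_nodes: NODES-discharged p405502; K1
  N_IUTchIII_Def1_1_iii.{u₁} ∧
  --  [IUTchIII:Def1.1(iv)] d_nodes: NODES-discharged p406839; K1
  N_IUTchIII_Def1_1_iv.{u₁} ∧
  --  [IUTchIII:Def1.1(v)] d_nodes: NODES-discharged p404450; K1
  N_IUTchIII_Def1_1_v ∧
  --  [IUTchIII:Def1.1(vi)] d_nodes: NODES-discharged p406839; K1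
  N_IUTchIII_Def1_1_vi.{u₁} ∧
  --  [IUTchIII:Def1.4] d_nodes: NODES-discharged p403690; K1
  N_IUTchIII_Def1_4 ∧
  --  [IUTchIII:Def2.4(i)] d_nodes: NODES-discharged p404180; K1
  N_IUTchIII_Def2_4_i.{u₁} ∧
  --  [IUTchIII:Def2.4(ii)] d_nodes: NODES-discharged p404180; K1
  N_IUTchIII_Def2_4_ii.{u₁, u₂, u₃} ∧
  --  [IUTchIII:Def3.8(ii)] d_nodes: NODES-discharged p403728; K1
  N_IUTchIII_Def3_8_ii.{u₁, u₂, u₃} ∧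
  --  [IUTchIII:Ex3.6(ii)] d_nodes: NODES-discharged p412161; K1
  N_IUTchIII_Ex3_6_ii.{u₁, u₂, u₃} ∧
  --  [IUTchIII:Prop1.2(i)] d_nodes: NODES-discharged p405502; K1
  N_IUTchIII_Prop1_2_i'.{u₁} ∧
  N_IUTchIII_Prop1_2_i_r4.{u₁} ∧
  --  [IUTchIII:Prop1.2(ii)] d_nodes: NODES-discharged p404642; K1
  N_IUTchIII_Prop1_2_ii'.{u₁, u₂} ∧
  N_IUTchIII_Prop1_2_ii_r4.{u₁, u₂} ∧
  --  [IUTchIII:Prop1.2(iii)] d_nodes: NODES-discharged p406453; K1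
  N_IUTchIII_Prop1_2_iii.{u₁, u₂} ∧
  N_IUTchIII_Prop1_2_iii_r10 ∧
  --  [IUTchIII:Prop1.2(iv)] d_nodes: NODES-discharged p404642; K1
  N_IUTchIII_Prop1_2_iv.{u₁} ∧
  --  [IUTchIII:Prop1.2(ix)] d_nodes: NODES-discharged p411776; K1
  N_IUTchIII_Prop1_2_ix.{u₁} ∧
  N_IUTchIII_Prop1_2_ix_r21.{u₁} ∧
  --  [IUTchIII:Prop1.2(v)] d_nodes: NODES-discharged p406453; K1
  N_IUTchIII_Prop1_2_v.{u₁} ∧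
  N_IUTchIII_Prop1_2_v_r13.{u₁} ∧
  N_IUTchIII_Prop1_2_v_r14.{u₁} ∧
  --  [IUTchIII:Prop1.2(vi)] d_nodes: NODES-discharged p406453; K1
  N_IUTchIII_Prop1_2_vi'.{u₁} ∧
  --  [IUTchIII:Prop1.2(vii)] d_nodes: NODES-discharged p406839; K1
  N_IUTchIII_Prop1_2_vii'.{u₁} ∧
  N_IUTchIII_Prop1_2_vii_r19 ∧
  --  [IUTchIII:Prop1.2(viii)] d_nodes: NODES-discharged p411776; K1
  N_IUTchIII_Prop1_2_viii.{u₁} ∧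
  --  [IUTchIII:Prop1.2(x)] d_nodes: NODES-discharged p405502; K1
  N_IUTchIII_Prop1_2_x ∧
  --  [IUTchIII:Prop1.3(i)] d_nodes: NODES-discharged p406456; K1
  N_IUTchIII_Prop1_3_i.{u₁} ∧
  N_IUTchIII_Prop1_3_i_r4.{u₁} ∧
  N_IUTchIII_Prop1_3_i_r4a.{u₁} ∧
  --  [IUTchIII:Prop1.3(ii)] d_nodes: NODES-discharged p406456; K1
  N_IUTchIII_Prop1_3_ii.{u₁} ∧
  N_IUTchIII_Prop1_3_ii_r5.{u₁} ∧
  --  [IUTchIII:Prop1.3(iii)] d_nodes: NODES-discharged p406456; K1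
  N_IUTchIII_Prop1_3_iii'.{u₁} ∧
  N_IUTchIII_Prop1_3_iii_r6'.{u₁} ∧
  --  [IUTchIII:Prop1.3(iv)] d_nodes: NODES-discharged p406456; K1
  N_IUTchIII_Prop1_3_iv ∧
  --  [IUTchIII:Prop2.1(i)] d_nodes: NODES-discharged p405523; K1
  N_IUTchIII_Prop2_1_i'.{u₁} ∧
  N_IUTchIII_Prop2_1_i_r3.{u₁, u₂, u₃} ∧
  N_IUTchIII_Prop2_1_i_r10.{u₁} ∧
  --  [IUTchIII:Prop2.1(ii)] d_nodes: NODES-discharged p405523; K1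
  N_IUTchIII_Prop2_1_ii.{u₁} ∧
  N_IUTchIII_Prop2_1_ii_r12.{u₁} ∧
  --  [IUTchIII:Prop2.1(iii)] d_nodes: NODES-discharged p405523; K1
  N_IUTchIII_Prop2_1_iii.{u₁, u₂, u₃} ∧
  N_IUTchIII_Prop2_1_iii_r24.{u₁, u₂} ∧
  --  [IUTchIII:Prop2.1(iv)] d_nodes: NODES-discharged p422834; K1
  N_IUTchIII_Prop2_1_iv.{u₁} ∧
  N_IUTchIII_Prop2_1_iv_r17 ∧
  N_IUTchIII_Prop2_1_iv_r19.{u₁, u₂, u₃} ∧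
  --  [IUTchIII:Prop2.1(v)] d_nodes: NODES-discharged p422834; K1
  N_IUTchIII_Prop2_1_v ∧
  N_IUTchIII_Prop2_1_v_r22 ∧
  --  [IUTchIII:Prop2.1(vi)] d_nodes: NODES-discharged p405523; K2a
  N_IUTchIII_Prop2_1_vi ∧
  N_IUTchIII_Prop2_1_vi_r26 ∧
  --  [IUTchIII:Prop3.1(i)] d_nodes: NODES-discharged p408566; K3
  StatementOfB @Literature.RingTheory.Etale.piTensorProduct_pi_fields_exists_subalgebra_algEquiv_pi_field_of_charZero.{u₁, u₂, u₃, u₄} ∧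
  --  [IUTchIII:Prop3.1(ii)] d_nodes: NODES-discharged p407610; K1
  N_IUTchIII_Prop3_1_ii.{u₁, u₂, u₃, u₄} ∧
  --  [IUTchIII:Prop3.10(ii)] d_nodes: NODES-discharged p404134; K2a
  N_IUTchIII_Prop3_10_ii.{u₁, u₂} ∧
  N_IUTchIII_Prop3_10_ii_r12.{u₁, u₂, u₃} ∧
  N_IUTchIII_Prop3_10_ii_r14.{u₁, u₂} ∧
  --  [IUTchIII:Prop3.10(iii)] d_nodes: NODES-discharged p411539; K1
  N_IUTchIII_Prop3_10_iii'.{u₁} ∧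
  N_IUTchIII_Prop3_10_iii_r16.{u₁} ∧
  --  [IUTchIII:Prop3.2(ii)] d_nodes: NODES-discharged p407610; K1
  N_IUTchIII_Prop3_2_ii.{u₁, u₂} ∧
  --  [IUTchIII:Prop3.3(i)] d_nodes: NODES-discharged p407610; K1
  N_IUTchIII_Prop3_3_i.{u₁, u₂, u₃, u₄, u₅, u₆} ∧
  N_IUTchIII_Prop3_3_i_P33i_L02.{u₁, u₂, u₃} ∧
  N_IUTchIII_Prop3_3_i_P33i_L03.{u₁, u₂} ∧
  N_IUTchIII_Prop3_3_i_P33i_L04.{u₁, u₂, u₃, u₄, u₅, u₆} ∧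
  N_IUTchIII_Prop3_3_i_P33i_L05 ∧
  N_IUTchIII_Prop3_3_i_P33i_L08 ∧
  --  [IUTchIII:Prop3.3(ii)] d_nodes: NODES-discharged p412179; K1
  N_IUTchIII_Prop3_3_ii.{u₁, u₂} ∧
  N_IUTchIII_Prop3_3_ii_P33ii_L09.{u₁, u₂} ∧
  N_IUTchIII_Prop3_3_ii_P33ii_L10.{u₁, u₂} ∧
  N_IUTchIII_Prop3_3_ii_P33ii_L11 ∧
  N_IUTchIII_Prop3_3_ii_P33ii_L12 ∧
  N_IUTchIII_Prop3_3_ii_P33ii_L13 ∧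
  --  [IUTchIII:Prop3.4(i)] d_nodes: NODES-discharged p407610; K1
  N_IUTchIII_Prop3_4_i.{u₁, u₂, u₃} ∧
  N_IUTchIII_Prop3_4_i_r4.{u₁, u₂, u₃} ∧
  N_IUTchIII_Prop3_4_i_r6.{u₁, u₂, u₃} ∧
  N_IUTchIII_Prop3_4_i_r7.{u₁, u₂, u₃, u₄} ∧
  --  [IUTchIII:Prop3.4(ii)] d_nodes: NODES-discharged p422157; K3; also also constructed (data):
  --   N_IUTchIII_Prop3_4_ii := @Literature.IUT.LogThetaLattice.LGPMonoidSignature (p403901)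
  N_IUTchIII_Prop3_4_ii_r16.{u₁, u₂} ∧
  N_IUTchIII_Prop3_4_ii_r17.{u₁} ∧
  --  [IUTchIII:Prop3.5(i)] d_nodes: NODES-discharged p403904; K2a
  N_IUTchIII_Prop3_5_i.{u₁, u₂} ∧
  N_IUTchIII_Prop3_5_i_r6.{u₁, u₂} ∧
  N_IUTchIII_Prop3_5_i_r9.{u₁, u₂, u₃} ∧
  N_IUTchIII_Prop3_5_i_r10.{u₁} ∧
  --  [IUTchIII:Prop3.5(ii)] d_nodes: NODES-discharged p411733; K1
  N_IUTchIII_Prop3_5_ii.{u₁, u₂} ∧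
  N_IUTchIII_Prop3_5_ii_r15.{u₁, u₂, u₃} ∧
  N_IUTchIII_Prop3_5_ii_r23 ∧
  --  [IUTchIII:Prop3.7(i)] d_nodes: NODES-discharged p413105; K2a
  N_IUTchIII_Prop3_7_i'.{u₁} ∧
  N_IUTchIII_Prop3_7_i_r8.{u₁, u₂} ∧
  N_IUTchIII_Prop3_7_i_r9.{u₁, u₂, u₃} ∧
  N_IUTchIII_Prop3_7_i_r10.{u₁, u₂, u₃} ∧
  --  [IUTchIII:Prop3.7(ii)] d_nodes: NODES-discharged p412491; K1
  N_IUTchIII_Prop3_7_ii.{u₁} ∧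
  N_IUTchIII_Prop3_7_ii_r11.{u₁, u₂, u₃} ∧
  N_IUTchIII_Prop3_7_ii_r13 ∧
  --  [IUTchIII:Prop3.7(iv)] d_nodes: NODES-discharged p412468; K2a
  N_IUTchIII_Prop3_7_iv ∧
  --  [IUTchIII:Prop3.7(v)] d_nodes: NODES-discharged p412551; K1
  N_IUTchIII_Prop3_7_v.{u₁} ∧
  N_IUTchIII_Prop3_7_v_r22.{u₁} ∧
  --  [IUTchIII:Prop3.9(i)] d_nodes: NODES-discharged p404053; K1
  N_IUTchIII_Prop3_9_i.{u₁, u₂} ∧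
  N_IUTchIII_Prop3_9_i_r3.{u₁, u₂, u₃} ∧
  N_IUTchIII_Prop3_9_i_r4.{u₁, u₂} ∧
  N_IUTchIII_Prop3_9_i_r5.{u₁, u₂} ∧
  N_IUTchIII_Prop3_9_i_r6.{u₁, u₂} ∧
  N_IUTchIII_Prop3_9_i_r8.{u₁, u₂} ∧
  N_IUTchIII_Prop3_9_i_r9 ∧
  --  [IUTchIII:Prop3.9(ii)] d_nodes: NODES-discharged p411342; K3
  N_IUTchIII_Prop3_9_ii_r11.{u₁, u₂} ∧
  N_IUTchIII_Prop3_9_ii_r12.{u₁} ∧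
  N_IUTchIII_Prop3_9_ii_r13.{u₁} ∧
  N_IUTchIII_Prop3_9_ii_r14.{u₁} ∧
  N_IUTchIII_Prop3_9_ii_r15.{u₁} ∧
  --  [IUTchIII:Prop3.9(iii)] d_nodes: NODES-discharged p408363; K1
  N_IUTchIII_Prop3_9_iii'.{u₁} ∧
  N_IUTchIII_Prop3_9_iii_r18.{u₁, u₂} ∧
  N_IUTchIII_Prop3_9_iii_r19.{u₁, u₂} ∧
  N_IUTchIII_Prop3_9_iii_r21.{u₁} ∧
  --  [IUTchIII:Prop3.9(iv)] d_nodes: NODES-discharged p413077; K3; also also constructed (data):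
  --   N_IUTchIII_Prop3_9_iv := @Literature.IUT.LogThetaLattice.Prop39iv_a (p413077)
  N_IUTchIII_Prop3_9_iv_r24.{u₁} ∧
  N_IUTchIII_Prop3_9_iv_r26.{u₁, u₂} ∧
  --  [IUTchIII:Thm1.5(i)] d_nodes: NODES-discharged p411547; K1
  N_IUTchIII_Thm1_5_i ∧
  N_IUTchIII_Thm1_5_i_r2.{u₁} ∧
  --  [IUTchIII:Thm1.5(ii)] d_nodes: NODES-discharged p411547; K1
  N_IUTchIII_Thm1_5_ii ∧
  N_IUTchIII_Thm1_5_ii_r3.{u₁} ∧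
  --  [IUTchIII:Thm1.5(iii)] d_nodes: NODES-discharged p411984; K1
  N_IUTchIII_Thm1_5_iii.{u₁} ∧
  N_IUTchIII_Thm1_5_iii_r7.{u₁} ∧
  --  [IUTchIII:Thm1.5(iv)] d_nodes: NODES-discharged p411998; K1
  N_IUTchIII_Thm1_5_iv.{u₁} ∧
  N_IUTchIII_Thm1_5_iv_r11.{u₁} ∧
  --  [IUTchIII:Thm1.5(v)] d_nodes: NODES-discharged p406839; K2a
  N_IUTchIII_Thm1_5_v.{u₁} ∧
  --  [IUTchIII:Thm2.2(i)] d_nodes: NODES-discharged p412150; K1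
  N_IUTchIII_Thm2_2_i.{u₁} ∧
  N_IUTchIII_Thm2_2_i_r2.{u₁} ∧
  N_IUTchIII_Thm2_2_i_r4.{u₁, u₂, u₃, u₄} ∧
  --  [IUTchIII:Thm2.2(ii)] d_nodes: NODES-discharged p412150; K1
  N_IUTchIII_Thm2_2_ii.{u₁, u₂} ∧
  N_IUTchIII_Thm2_2_ii_r6.{u₁, u₂} ∧
  N_IUTchIII_Thm2_2_ii_r9.{u₁} ∧
  N_IUTchIII_Thm2_2_ii_r11.{u₁, u₂} ∧
  N_IUTchIII_Thm2_2_ii_r15.{u₁, u₂} ∧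
  N_IUTchIII_Thm2_2_ii_r16.{u₁} ∧
  N_IUTchIII_Thm2_2_ii_r17.{u₁}

/-- `Layer6DischargedB` holds: every conjunct is a landed kernel theorem cited BY NAME (`DAG.N_<id>_holds` / `_part` /
`N_<id>_r<n>_holds` from the index parts DAGL6b/c/s/t/u/x/y/z/za/zb, DAGC312k/n and the update part DAGUa; one closing theorem
via `StatementOfB`). Proves nothing new. [claim: Mochizuki2012, status: disputed] -/
theorem layer6DischargedB_holds.{u₁, u₂, u₃, u₄, u₅, u₆} : Layer6DischargedB.{u₁, u₂, u₃, u₄, u₅, u₆} :=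
  ⟨@N_IUTchIII_Cor2_3_i_holds, @N_IUTchIII_Cor2_3_ii_holds, @N_IUTchIII_Cor2_3_ii_r3_holds,
    @N_IUTchIII_Cor2_3_ii_r5_holds, @N_IUTchIII_Cor2_3_ii_r6_holds, @N_IUTchIII_Cor2_3_iii_holds,
    @N_IUTchIII_Cor2_3_iii_r12_holds, @N_IUTchIII_Cor2_3_iv_holds, @N_IUTchIII_Cor2_3_iv_r14_holds,
    @N_IUTchIII_Cor2_3_iv_r15_holds, @N_IUTchIII_Cor2_3_iv_r17_holds, @N_IUTchIII_Def1_1_i_holds,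
    @N_IUTchIII_Def1_1_ii_holds, @N_IUTchIII_Def1_1_iii_holds, @N_IUTchIII_Def1_1_iv_holds,
    @N_IUTchIII_Def1_1_v_holds, @N_IUTchIII_Def1_1_vi_holds, @N_IUTchIII_Def1_4_holds, @N_IUTchIII_Def2_4_i_holds,
    @N_IUTchIII_Def2_4_ii_holds, @N_IUTchIII_Def3_8_ii_holds, @N_IUTchIII_Ex3_6_ii_holds,
    @N_IUTchIII_Prop1_2_i'_holds, @N_IUTchIII_Prop1_2_i_r4_holds, @N_IUTchIII_Prop1_2_ii'_holds,
    @N_IUTchIII_Prop1_2_ii_r4_holds, @N_IUTchIII_Prop1_2_iii_holds, @N_IUTchIII_Prop1_2_iii_r10_holds,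
    @N_IUTchIII_Prop1_2_iv_holds, @N_IUTchIII_Prop1_2_ix_holds, @N_IUTchIII_Prop1_2_ix_r21_holds,
    @N_IUTchIII_Prop1_2_v_holds, @N_IUTchIII_Prop1_2_v_r13_holds, @N_IUTchIII_Prop1_2_v_r14_holds,
    @N_IUTchIII_Prop1_2_vi'_holds, @N_IUTchIII_Prop1_2_vii'_holds, @N_IUTchIII_Prop1_2_vii_r19_holds,
    @N_IUTchIII_Prop1_2_viii_holds, @N_IUTchIII_Prop1_2_x_holds, @N_IUTchIII_Prop1_3_i_holds,
    @N_IUTchIII_Prop1_3_i_r4_holds, @N_IUTchIII_Prop1_3_i_r4a_holds, @N_IUTchIII_Prop1_3_ii_holds,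
    @N_IUTchIII_Prop1_3_ii_r5_holds, @N_IUTchIII_Prop1_3_iii'_holds, @N_IUTchIII_Prop1_3_iii_r6'_holds,
    @N_IUTchIII_Prop1_3_iv_holds, @N_IUTchIII_Prop2_1_i'_holds, @N_IUTchIII_Prop2_1_i_r3_holds,
    @N_IUTchIII_Prop2_1_i_r10_holds, @N_IUTchIII_Prop2_1_ii_holds, @N_IUTchIII_Prop2_1_ii_r12_holds,
    @N_IUTchIII_Prop2_1_iii_holds, @N_IUTchIII_Prop2_1_iii_r24_holds, @N_IUTchIII_Prop2_1_iv_holds,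
    @N_IUTchIII_Prop2_1_iv_r17_holds, @N_IUTchIII_Prop2_1_iv_r19_holds, @N_IUTchIII_Prop2_1_v_holds,
    @N_IUTchIII_Prop2_1_v_r22_holds, @N_IUTchIII_Prop2_1_vi_part, @N_IUTchIII_Prop2_1_vi_r26_holds,
    @Literature.RingTheory.Etale.piTensorProduct_pi_fields_exists_subalgebra_algEquiv_pi_field_of_charZero,
    @N_IUTchIII_Prop3_1_ii_holds, @N_IUTchIII_Prop3_10_ii_part, @N_IUTchIII_Prop3_10_ii_r12_holds,
    @N_IUTchIII_Prop3_10_ii_r14_holds, @N_IUTchIII_Prop3_10_iii'_holds, @N_IUTchIII_Prop3_10_iii_r16_holds,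
    @N_IUTchIII_Prop3_2_ii_holds, @N_IUTchIII_Prop3_3_i_holds, @N_IUTchIII_Prop3_3_i_P33i_L02_holds,
    @N_IUTchIII_Prop3_3_i_P33i_L03_holds, @N_IUTchIII_Prop3_3_i_P33i_L04_holds,
    @N_IUTchIII_Prop3_3_i_P33i_L05_holds, @N_IUTchIII_Prop3_3_i_P33i_L08_holds, @N_IUTchIII_Prop3_3_ii_holds,
    @N_IUTchIII_Prop3_3_ii_P33ii_L09_holds, @N_IUTchIII_Prop3_3_ii_P33ii_L10_holds,
    @N_IUTchIII_Prop3_3_ii_P33ii_L11_holds, @N_IUTchIII_Prop3_3_ii_P33ii_L12_holds,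
    @N_IUTchIII_Prop3_3_ii_P33ii_L13_holds, @N_IUTchIII_Prop3_4_i_holds, @N_IUTchIII_Prop3_4_i_r4_holds,
    @N_IUTchIII_Prop3_4_i_r6_holds, @N_IUTchIII_Prop3_4_i_r7_holds, @N_IUTchIII_Prop3_4_ii_r16_holds,
    @N_IUTchIII_Prop3_4_ii_r17_holds, @N_IUTchIII_Prop3_5_i_part, @N_IUTchIII_Prop3_5_i_r6_holds,
    @N_IUTchIII_Prop3_5_i_r9_holds, @N_IUTchIII_Prop3_5_i_r10_holds, @N_IUTchIII_Prop3_5_ii_holds,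
    @N_IUTchIII_Prop3_5_ii_r15_holds, @N_IUTchIII_Prop3_5_ii_r23_holds, @N_IUTchIII_Prop3_7_i'_part,
    @N_IUTchIII_Prop3_7_i_r8_holds, @N_IUTchIII_Prop3_7_i_r9_holds, @N_IUTchIII_Prop3_7_i_r10_holds,
    @N_IUTchIII_Prop3_7_ii_holds, @N_IUTchIII_Prop3_7_ii_r11_holds, @N_IUTchIII_Prop3_7_ii_r13_holds,
    @N_IUTchIII_Prop3_7_iv_part, @N_IUTchIII_Prop3_7_v_holds, @N_IUTchIII_Prop3_7_v_r22_holds,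
    @N_IUTchIII_Prop3_9_i_holds, @N_IUTchIII_Prop3_9_i_r3_holds, @N_IUTchIII_Prop3_9_i_r4_holds,
    @N_IUTchIII_Prop3_9_i_r5_holds, @N_IUTchIII_Prop3_9_i_r6_holds, @N_IUTchIII_Prop3_9_i_r8_holds,
    @N_IUTchIII_Prop3_9_i_r9_holds, @N_IUTchIII_Prop3_9_ii_r11_holds, @N_IUTchIII_Prop3_9_ii_r12_holds,
    @N_IUTchIII_Prop3_9_ii_r13_holds, @N_IUTchIII_Prop3_9_ii_r14_holds, @N_IUTchIII_Prop3_9_ii_r15_holds,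
    @N_IUTchIII_Prop3_9_iii'_holds, @N_IUTchIII_Prop3_9_iii_r18_holds, @N_IUTchIII_Prop3_9_iii_r19_holds,
    @N_IUTchIII_Prop3_9_iii_r21_holds, @N_IUTchIII_Prop3_9_iv_r24_holds, @N_IUTchIII_Prop3_9_iv_r26_holds,
    @N_IUTchIII_Thm1_5_i_holds, @N_IUTchIII_Thm1_5_i_r2_holds, @N_IUTchIII_Thm1_5_ii_holds,
    @N_IUTchIII_Thm1_5_ii_r3_holds, @N_IUTchIII_Thm1_5_iii_holds, @N_IUTchIII_Thm1_5_iii_r7_holds,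
    @N_IUTchIII_Thm1_5_iv_holds, @N_IUTchIII_Thm1_5_iv_r11_holds, @N_IUTchIII_Thm1_5_v_part,
    @N_IUTchIII_Thm2_2_i_holds, @N_IUTchIII_Thm2_2_i_r2_holds, @N_IUTchIII_Thm2_2_i_r4_holds,
    @N_IUTchIII_Thm2_2_ii_holds, @N_IUTchIII_Thm2_2_ii_r6_holds, @N_IUTchIII_Thm2_2_ii_r9_holds,
    @N_IUTchIII_Thm2_2_ii_r11_holds, @N_IUTchIII_Thm2_2_ii_r15_holds, @N_IUTchIII_Thm2_2_ii_r16_holds,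
    @N_IUTchIII_Thm2_2_ii_r17_holds⟩

/-- **L6 certificate, part B — RESIDUAL: EMPTY at NODES v3.4aq** (r = 0: every one of the 69 [IUTchIII] §1–3 cone members is
Discharged — d_nodes 61 + d_idx 0 — or listed data 8 / flagged 0). The definition keeps 3 CONTENT-FREE universe-carrying
conjuncts `∀ α : Sort u, Nonempty α → Nonempty α` only so that `Layer6ResidualB.{u₁, u₂, u₃}` stays well-typed for the TOP's binder
(`Layer6Residual := Layer6ResidualA ∧ Layer6ResidualB`); they are not cone rows and assert nothing. [claim: Mochizuki2012, status: disputed] -/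
def Layer6ResidualB.{u₁, u₂, u₃} : Prop :=
  --  [(universe-arity stabiliser, no content)] content-free conjunct carrying universe `u₁` so that
  --   `Layer6ResidualB` keeps 3 universe parameters for the TOP; witness `fun _ h => h`; NOT a cone row, not
  --   counted in r
  (∀ α : Sort u₁, Nonempty α → Nonempty α) ∧
  --  [(universe-arity stabiliser, no content)] content-free conjunct carrying universe `u₂` so that
  --   `Layer6ResidualB` keeps 3 universe parameters for the TOP; witness `fun _ h => h`; NOT a cone row, not
  --   counted in r
  (∀ α : Sort u₂, Nonempty α → Nonempty α) ∧
  --  [(universe-arity stabiliser, no content)] content-free conjunct carrying universe `u₃` so that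
  --   `Layer6ResidualB` keeps 3 universe parameters for the TOP; witness `fun _ h => h`; NOT a cone row, not
  --   counted in r
  (∀ α : Sort u₃, Nonempty α → Nonempty α)

/-- The [IUTchIII] §1–3 slice of the L6 cone: discharged part ∧ residual part. [claim: Mochizuki2012, status: disputed] -/
def Layer6ConeB.{u₁, u₂, u₃, u₄, u₅, u₆} : Prop :=
  Layer6DischargedB.{u₁, u₂, u₃, u₄, u₅, u₆} ∧ Layer6ResidualB.{u₁, u₂, u₃}

/-- The whole [IUTchIII] §1–3 slice follows from its residual alone (the discharged part is a kernel theorem).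
[claim: Mochizuki2012, status: disputed] -/
theorem layer6ConeB_of.{u₁, u₂, u₃, u₄, u₅, u₆} (h : Layer6ResidualB.{u₁, u₂, u₃}) : Layer6ConeB.{u₁, u₂, u₃, u₄, u₅, u₆} :=
  ⟨layer6DischargedB_holds, h⟩

/-- `Layer6ResidualB` is KERNEL-INHABITED: each residual conjunct has an index witness BY NAME (`DAG.N_<id>_part`, or `_holds`
for a re-keyed row). Inhabitation ≠ print coverage: discharged vs residual stays the NODES.md row status (r in the COUNT LINE).
Regenerated with the residual at every re-file (never stale). [claim: Mochizuki2012, status: disputed] -/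
theorem layer6ResidualB_inhabited.{u₁, u₂, u₃} : Layer6ResidualB.{u₁, u₂, u₃} :=
  ⟨fun _ h => h, fun _ h => h, fun _ h => h⟩

/-- Hence the whole [IUTchIII] §1–3 slice of the L6 cone holds outright (by name, for the TOP / apex). [claim: Mochizuki2012, status: disputed] -/
theorem layer6ConeB_holds.{u₁, u₂, u₃, u₄, u₅, u₆} : Layer6ConeB.{u₁, u₂, u₃, u₄, u₅, u₆} :=
  layer6ConeB_of layer6ResidualB_inhabited

end Summit.ABC.IUTFork.Conditional
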